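import Summits.QuantumFields.YangMills.Theorems.UnitScaleTiltProp7LandauDictT3
import Summits.QuantumFields.YangMills.Theorems.UnitScaleTiltProp7SectET3RealCoordSums
import Summits.QuantumFields.YangMills.Theorems.UnitScaleTiltProp7SPrintIn19Dict
import Summits.QuantumFields.YangMills.Theorems.UnitScaleTiltProp7AxialReprPrint
import Literature.MathematicalPhysics.QuantumFieldTheory.Balaban1983to89.B9Eq321LandauOrthogonalZdPer
import Literature.MathematicalPhysics.QuantumFieldTheory.Balaban1983to89.B9Eq325ProjFormulaZdLevels
import Literature.MathematicalPhysics.QuantumFieldTheory.Balaban1983to89.B10Eq29TubeLine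
import HarnessLib

/-!
# Route `UnitScaleTilt`, crux K1 «MinimiserStabilityRegPr» (stmt-QuantumFields-19200) — ARCHITECTURE (A′) «HCOW-VIA-Σ» (★★OWNER RULING g28-№13), EX namer ruling (27) (α):
# **THE LANDAU–COMB DICTIONARY** — print's projected Landau condition IN MULTIPLIER FORM (`Prop7SPrint.IsLandauPrint`, the predicate the (A′) representative carries,
# ✓`Prop7SigmaRepOfThm2S.exists_sigmaRep_of_thm2S`) IMPLIES the EQUATION `R(W)(D*_W X̃) = 0` on the member's weighted `L²` space of gauge parameters for the COMB
# projector `R(W) = projR (Δ^η_W) Q′` of [Balaban1985BackgroundPropagators] (3.21) — the (LANDAU-S) conjunct of ✓`Prop7HcoWOfSigmaRowsSlots.hcoW_of_sigmaRowsW_slots`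
# at the comb slot `(Rr, Qc) := (comb R, QTw)` — for EVERY `ℂ`-linear averaging `Q′` whose kernel lies in print's residual algebra `N(Q′_k(W))`

Cell `ym3-torus` ∕ width seat `ym-ust-19200-w1` (gen 14).  THEOREMS ONLY (0 `def`, 0 `sorry`); `--supports stmt-QuantumFields-19200 --as helper`, count-neutral.
YM₃ on T³ is a ladder rung (R3), not d = 4, not infinite volume, not the Clay problem; nothing here claims the stub, the crux, `hcoW`, [B9] Thm 3.11 or the mass gap.

THE PRINT.  [Balaban1985Variational] (21) p. 281 «R(U₀)D^{η*}_{U₀}A = 0»; [Balaban1985RegularSpaces] (1.38) p. 82 (the same, with `R(U₀)` «the orthogonal projection onto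
Δ^η_{U₀}N(Q′(U₀))», (1.42) p. 83); [Balaban1985BackgroundPropagators] (3.19) p. 393 (the averaging `Q′_j(U)` of gauge parameters with the transporters `R(U(Γ))`),
(3.20)–(3.21) p. 394 «R = R(U) is an orthogonal projection in the Hilbert space L²(Ω₀, 𝔤) onto the subspace ℛ = Δ^η_U N(Q′), N(Q′) = {λ : Q′λ = 0}», (3.23) `Δ^η_U = D^{η*}_U D^η_U`,
p. 391 «the adjoints are taken with respect to natural L² scalar products».

WHY (★p1 g17 WORD 12 (S-ii), ★w2-19200 g7 ruling (27), 2026-08-29).  The E′ junction door ✓`hcoW_of_sigmaRowsW_slots` carries the gauge projector `Rr` as a SLOT and states its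
(LANDAU-S) row as the EQUATION `Rr W (DstarL2 W (toL2 (ηA))) = 0`; ruling (27) instantiates `(Rr, Qc) :=` (comb `R`, `QTw`) and reads (LANDAU) as `IsLandauPrint` «inhabited by
✓p687911 as is».  The symmetric lane has this dictionary as a theorem because `IsLandauPrintS` is DEFINED Hilbert-side (✓`Prop7SPrint.isLandauPrintS_iff_RS`); the comb predicate
`IsLandauPrint` is the `ℤ³`-lane MULTIPLIER form `B8Eq138LandauZd.IsLandau138` («Δ^η_{U₀}(D^{η*}A) = Q′ᵀμ») on the based pullbacks.  This file supplies the missing arrow: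
multiplier form ⟹ orthogonality `D*_W X̃ ⊥ Δ^η_W N(Q′_k(W))` in the member's `L²` (pub-ymgap's periodic-cell identity
`B9Eq321LandauOrthogonalZdPer.sum_box_trace_covLap_mul_covDivB_eq_zero_of_isLandau138` read on T³ through the route's pull dictionary) ⟹ `projR (Δ^η_W) Q′ (D*_W X̃) = 0` for ANY
`ℂ`-linear `Q′` on the gauge parameters with `ker Q′ ⊆ N(Q′_k(W))` — so the door's comb instantiation is fed BY `exact`, whatever concrete `Q′` object the namer chooses.

WHAT IS PROVED (ns `…Theorems.Prop7LandauCombDict`; member `F`, heights `n ≤ K`, `k = K − n`, weight `c₀ > 0`, background `W`, one-form `X`):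
* §1 (torus ↔ period cell) `transl_add_period`, `isPeriodic_comp_transl`, `isPeriodic_pull`, ★`sum_univ_eq_sum_box_transl` (`Σ_{x ∈ T} f x = Σ_{z ∈ [0,N)ᵈ} f(y + z)`),
  `pow_dvd_sitesPerDir_zero` (`Lᵏ ∣ 2L^{m+K}`);
* §2 (pull dictionary, second order) `covDivB_pull` (`D^{η*}` of the pulled form = pull of `covDivFormT`), ★`covLap_pull_site` (`Δ^η` of the pulled gauge parameter = pull of the route's
  site Laplacian `covDivFormT ∘ covDerivFwdT`), `covLapSite_toL2S_eq` ∕ `DstarL2_toL2_eq` (brick L0a's `covLapSite`, `DstarL2` are `toL2S` of those route letters);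
* §3 `pull_bgUnits_mem_unitaryUnits`; ★★`inner_covLapSite_DstarL2_eq_zero_of_isLandau138` — `IsLandau138 L k η ℤ³ (torusLam k) W♯ A♯` (the RAW letter of the `hcoW` prefix ∕ of
  `IsLandauPrint`), the tower transporters `W̄ʲ(Γ)` unitary for `j ≤ k`, `Q′_k(W)λ♯ = 0` ⟹ `⟪Δ^η_W λ̃, D*_W Ã⟫_ℂ = 0`; ★★★`projR_covLapSite_eq_zero_of_isLandau138` ∕
  ★★★`projR_covLapSite_eq_zero_of_isLandauPrint` — for every `ℂ`-linear `Q′` with `ker Q′ ⊆ N(Q′_k(W))`: `projR (covLapSite W) Q′ (DstarL2 W (toL2 A)) = 0` (resp. `… (toL2 X)` from `IsLandauPrint W X`)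
  (the door's (LANDAU-S) equation at the comb slot); `projR_covLapSite_smul_eq_zero_of_isLandau138` (door letters `toL2 (c • A)`, `c := eta F n K`);
  `RLatticeK_smul_eq_zero_of_isLandau138` ∕ `RLatticeK_eq_zero_of_isLandauPrint` (the same in lit-balaban's `RLatticeK η⁻¹ (adBg W) (adBgInv W) Q′` letter of ✓`Prop7SectET3GaugeProjector.RS`,
  `= projR (covLapSite W) Q′` by ✓`covLapSite_eq`);
* §4 ★`bgT_pull_mem_unitaryUnits_of_regPr` — at a printed-regular background `W ∈ 𝔘_k(a)` with `C₀·2a ≤ ⅓`, `4a ≤ c₂′` the transporters are `SU(2)`-valued for `j ≤ k`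
  ([Balaban1985Averaging] Prop. 2), hence ★★★`projR_covLapSite_smul_eq_zero_of_isLandau138_of_regPr` ∕ ★★★`projR_covLapSite_eq_zero_of_isLandauPrint_of_regPr` (the member reading:
  hypotheses = `RegPr` + the Landau letter + the kernel inclusion `hQ'`, nothing else).
THE KERNEL INCLUSION `hQ'`.  `∀ v, Q′ v = 0 → ∀ y, QprimeIter (zdBlocking 3 L) (bgT L W♯) k (z ↦ (toL2S⁻¹ v)(x₀ + z)) y = 0` — «`ker Q′ ⊆ N(Q′_k(W))`» with print's `Q′_k(W)` written in the SAME
`ℤ³`-lane letters as `IsLandauPrint` (based pullback at `x₀ = basePt F n K`, transporters `bgT`); for the print-literal `Q′ := Q′_k(W)` read on `L²` it is an `Iff`, and any `Q′` with a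
SMALLER kernel is admissible.  The symmetric∕`QDS`-type kernels `ker(Q∘D_W)` are LARGER than `N(Q′_k(W))` by the coarse `W̄`-covariantly-constant sections (✓`Prop7SPrintDefsS` :150–153 at
`W = 1`); for those the multiplier form does not give the slot equation and this file says nothing (ruling (27) chose the comb pair).
HONEST SCOPE.  Re-indexing (torus sums as cell sums, pullbacks) over pub-ymgap's landed cell identity and the lineage's landed dictionaries; no estimate; [B9] Thm 3.11 ∕ Thm 3.3 are NOT
proved; the EX display's `hcoW` text is untouched; nothing of (A′) ∕ E′ ∕ EX ∕ the crux is claimed.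

References: T. Bałaban, CMP **102** (1985) 277–309 [Balaban1985Variational] ((21) p.281); CMP **99** (1985) 75–102 [Balaban1985RegularSpaces] ((1.1)–(1.2) p.76, p.77, (1.38) p.82,
(1.42) p.83); CMP **99** (1985) 389–434 [Balaban1985BackgroundPropagators] (p.391, (3.8) p.392, (3.17)–(3.19) p.393, (3.20)–(3.23) p.394); CMP **98** (1985) 17–51 [Balaban1985Averaging]
((52)–(53) p.26, (78)–(80) p.30).
-/

set_option autoImplicit false

noncomputable section

open scoped Matrix.Norms.L2Operator InnerProductSpace BigOperators

namespace Summit.QuantumFields.YangMills.Theorems.Prop7LandauCombDict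

open Literature.MathematicalPhysics.QuantumFieldTheory.Balaban1983to89
open Literature.MathematicalPhysics.QuantumFieldTheory.Balaban1983to89.T3ContinuumYM3Torus
open Literature.MathematicalPhysics.QuantumFieldTheory.Balaban1983to89.T3PrintedRegularMinimiser (RegPr)
open B7Prop1Explicit renaming Site → LSite
open B7Prop2Explicit (avgIter pdev C0 c2' avgIter_mem unitaryUnits hol_mem_of)
open B7Prop2SpecialUnitary (specialUnitaryUnits specialUnitaryUnits_le_unitaryUnits)
open B7AvgClosedSpecialUnitarySharp (avgClosed_specialUnitary_of_le_twentyone)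
open B7Eq78Linearization (QprimeIter zdBlocking conjR)
open B8Ineq132 (covDeriv covDerivFwd)
open B8Eq119TwistedAxial (bgT)
open B8Eq138LandauZd (covLap covDivB IsLandau138)
open B8Thm4TorusAt (torusLam)
open B10Eq27TorusAxialLog (transl transl_add transl_add_e pull pull_apply unitsField toUField unitsField_mem_unitaryUnits)
open B10Eq68TorusRegularity (covDerivT covDeriv_pull)
open T4TermwiseTorus (IsPeriodic box mem_box tcls tlift tcls_apply tlift_mem_box tlift_tcls_of_mem_box tcls_tlift)
open T3SectALandauChart (covDerivFwdT formComp covDivFormT bgUnits eta eta_pos)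
open B11Eq103H1Complex (SiteL2K BondL2K projR RLatticeK)
open Summit.QuantumFields.YangMills.Theorems.Prop7SectET3Transport (periodsT3)
open Summit.QuantumFields.YangMills.Theorems.Prop7SectET3HilbertLetters (W₂ adBg adBgInv toL2 toL2S DL2 DstarL2 covLapSite covLapSite_eq)
open Summit.QuantumFields.YangMills.Theorems.Prop7SectET3RealCoordSums (inner_toL2S)
open Summit.QuantumFields.YangMills.Theorems.Prop7LandauDict (DL2_toL2S_eq_covDerivFwdT DstarL2_toL2_eq_covDivFormT)
open Summit.QuantumFields.YangMills.Theorems.Prop7SPrintIn19 (covDerivFwd_pull)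
open Summit.QuantumFields.YangMills.Theorems.Prop7SPrint (basePt IsLandauPrint)
open Summit.QuantumFields.YangMills.Theorems.Prop7AxialReprPrint (pdev_pull_lt inAk_pull_of_regPr pull_toUField_mem)

/-! ## §1 Torus sums as sums over the period cell; periodicity of pullbacks -/

section Torus

variable {P : Params} {j : ℕ}

/-- Translating by a whole period does nothing on the torus: `y + (z + N·m) = y + z`, `N = sitesPerDir j`. [cite: Balaban1985RegularSpaces, p.77 («Ω_j = T_η»)] -/
theorem transl_add_period (y : Site P j) (z m : LSite P.d) :
    transl y (z + ((P.sitesPerDir j : ℕ) : ℤ) • m) = transl y z := by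
  funext ν
  simp only [transl, Pi.add_apply, Pi.smul_apply, smul_eq_mul, Int.cast_add, Int.cast_mul, Int.cast_natCast, ZMod.natCast_self, zero_mul,
    add_zero]

/-- A torus function read on `ℤᵈ` through `z ↦ y + z` is `N`-periodic. [cite: Balaban1985RegularSpaces, p.77 («Ω_j = T_η»)] -/
theorem isPeriodic_comp_transl {β : Sort*} (y : Site P j) (f : Site P j → β) :
    IsPeriodic (P.sitesPerDir j) (fun z => f (transl y z)) := fun z m => by
  show f (transl y (z + _)) = f (transl y z)
  rw [transl_add_period]

/-- The based pullback of a gauge field is `N`-periodic. [cite: Balaban1985RegularSpaces, (1.3) p.77] -/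
theorem isPeriodic_pull {G : Type*} (V : GaugeField P j G) (y : Site P j) : IsPeriodic (P.sitesPerDir j) (pull V y) := fun z m => by
  funext μ
  rw [pull_apply, pull_apply, transl_add_period]

/-- ★ **A TORUS SUM IS A SUM OVER ONE PERIOD CELL**: `Σ_{x ∈ T^{(j)}} f x = Σ_{z ∈ [0,N)ᵈ} f (y + z)` for any base `y` (`z ↦ y + z` is a bijection `[0,N)ᵈ → T^{(j)}`).
[cite: Balaban1985RegularSpaces, p.77 («Ω_j = T_η»)] -/
theorem sum_univ_eq_sum_box_transl {M : Type*} [AddCommMonoid M] (y : Site P j) (f : Site P j → M) :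
    ∑ x : Site P j, f x = ∑ z ∈ box (d := P.d) (P.sitesPerDir j), f (transl y z) := by
  classical
  symm
  refine Finset.sum_nbij' (fun z => transl y z) (fun x => tlift (fun κ => x κ - y κ)) (fun _ _ => Finset.mem_univ _)
    (fun x _ => tlift_mem_box _) (fun z hz => ?_) (fun x _ => ?_) (fun _ _ => rfl)
  · have h : (fun κ => transl y z κ - y κ) = tcls (P.sitesPerDir j) z := by
      funext κ; simp [transl, tcls_apply]
    rw [h, tlift_tcls_of_mem_box hz]
  · funext ν
    have h := congrFun (tcls_tlift (T := P.sitesPerDir j) (fun κ => x κ - y κ)) ν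
    rw [tcls_apply] at h
    show y ν + (((tlift fun κ => x κ - y κ) ν : ℤ) : ZMod (P.sitesPerDir j)) = x ν
    rw [h]; abel

end Torus

/-- `Lᵏ ∣ N₀ = 2·L^{m+K}` for `k = K − n`: every block lattice divides the finest torus ([B8] p. 77). [cite: Balaban1985RegularSpaces, p.77] -/
theorem pow_dvd_sitesPerDir_zero (F : T3Family) (n K : ℕ) : (F.P K).L ^ (K - n) ∣ (F.P K).sitesPerDir 0 := by
  show F.L ^ (K - n) ∣ 2 * F.L ^ (F.m + K - 0)
  exact Dvd.dvd.mul_left (pow_dvd_pow _ (by omega)) 2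

/-! ## §2 The pull dictionary for `D^{η*}` and `Δ^η` on gauge parameters, and brick L0a's letters as `toL2S` of route letters -/

section Pull

variable {P : Params} {s : ℕ} {𝔸 : Type*} [NormedRing 𝔸] [NormedAlgebra ℂ 𝔸]

/-- **DICTIONARY, (1.2) ∕ (3.8)**: the `ℤᵈ` covariant divergence of the pulled-back one-form along the pulled-back configuration is the route's `covDivFormT` at `y + z`.
[cite: Balaban1985RegularSpaces, (1.2) p.76; Balaban1985BackgroundPropagators, (3.8) p.392] -/
theorem covDivB_pull (η : ℝ) (V : GaugeField P s 𝔸ˣ) (X : PBond P s → 𝔸) (y : Site P s) (z : LSite P.d) :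
    covDivB η (pull V y) (pull X y) z = covDivFormT η V X (transl y z) := by
  unfold covDivB covDivFormT
  refine Finset.sum_congr rfl fun μ _ => ?_
  have h : (fun z' => pull X y z' μ) = fun z' => formComp X μ (transl y z') := funext fun z' => by rw [pull_apply]; rfl
  rw [h, covDeriv_pull]

/-- ★ **DICTIONARY, (3.23) `Δ^η_{U₀} = D^{η*}D^η` ON GAUGE PARAMETERS**: `covLap η V♯_y (λ ∘ (y + ·)) z = covDivFormT η V (b ↦ (D^η_{V,b.dir}λ)(b.src)) (y + z)`.
[cite: Balaban1985BackgroundPropagators, (3.23) p.394; Balaban1985RegularSpaces, (1.1)–(1.2) p.76] -/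
theorem covLap_pull_site (η : ℝ) (V : GaugeField P s 𝔸ˣ) (l : Site P s → 𝔸) (y : Site P s) (z : LSite P.d) :
    covLap η (pull V y) (fun z' => l (transl y z')) z = covDivFormT η V (fun b => covDerivFwdT η V b.2 l b.1) (transl y z) := by
  have h : (fun z' μ => covDerivFwd η (pull V y) μ (fun z'' => l (transl y z'')) z') = pull (fun b : PBond P s => covDerivFwdT η V b.2 l b.1) y := by
    funext z' μ
    rw [pull_apply, covDerivFwd_pull]
  unfold covLap
  rw [h, covDivB_pull]

end Pull

section Letters

variable (F : T3Family) (n K : ℕ) (c₀ : ℝ) [Fact (0 < c₀)]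

/-- **brick L0a's `D*_{U₀}` IS `toL2S` OF THE ROUTE'S DIVERGENCE**: `DstarL2 U₀ (toL2 X) = toL2S (x ↦ covDivFormT η (bgUnits U₀) X x)`. [cite: Balaban1985BackgroundPropagators, (3.8) p.392] -/
theorem DstarL2_toL2_eq (U₀ : GaugeField (F.P K) 0 (Matrix.specialUnitaryGroup (Fin 2) ℂ)) (X : PBond (F.P K) 0 → Matrix (Fin 2) (Fin 2) ℂ) :
    DstarL2 F n K c₀ U₀ (toL2 F K c₀ X) = toL2S F K c₀ (fun x => covDivFormT (eta F n K) (bgUnits F K U₀) X x) :=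
  (LinearEquiv.symm_apply_eq _).mp (funext fun x => DstarL2_toL2_eq_covDivFormT F n K c₀ U₀ X x)

/-- **brick L0a's `Δ^η_{U₀} = D*D` IS `toL2S` OF THE ROUTE'S SITE LAPLACIAN**: `covLapSite U₀ (toL2S λ) = toL2S (x ↦ covDivFormT η (bgUnits U₀) (b ↦ (D^η_{b.dir}λ)(b.src)) x)`.
[cite: Balaban1985BackgroundPropagators, (3.23) p.394, (3.3) p.391, (3.8) p.392] -/
theorem covLapSite_toL2S_eq (U₀ : GaugeField (F.P K) 0 (Matrix.specialUnitaryGroup (Fin 2) ℂ)) (l : Site (F.P K) 0 → Matrix (Fin 2) (Fin 2) ℂ) :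
    covLapSite F n K c₀ U₀ (toL2S F K c₀ l)
      = toL2S F K c₀ (fun x => covDivFormT (eta F n K) (bgUnits F K U₀) (fun b => covDerivFwdT (eta F n K) (bgUnits F K U₀) b.2 l b.1) x) := by
  have hD : DL2 F n K c₀ U₀ (toL2S F K c₀ l) = toL2 F K c₀ (fun b => covDerivFwdT (eta F n K) (bgUnits F K U₀) b.2 l b.1) :=
    (LinearEquiv.symm_apply_eq _).mp (funext fun b => DL2_toL2S_eq_covDerivFwdT F n K c₀ U₀ l b)
  show DstarL2 F n K c₀ U₀ (DL2 F n K c₀ U₀ (toL2S F K c₀ l)) = _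
  rw [hD, DstarL2_toL2_eq]

end Letters

/-! ## §3 Multiplier form ⟹ orthogonality ⟹ the projector equation, on the member's `L²` space -/

section Main

variable {F : T3Family} {n K : ℕ} {c₀ : ℝ} [Fact (0 < c₀)]

/-- The based pullback of the `SU(2)` background read in `M₂(ℂ)ˣ` is unitary-valued. [cite: Balaban1985Averaging, (19) p.21] -/
theorem pull_bgUnits_mem_unitaryUnits (W : GaugeField (F.P K) 0 (Matrix.specialUnitaryGroup (Fin 2) ℂ)) (x₀ : Site (F.P K) 0)
    (z : LSite (F.P K).d) (κ : Fin (F.P K).d) : pull (bgUnits F K W) x₀ z κ ∈ unitaryUnits (Matrix (Fin 2) (Fin 2) ℂ) := by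
  rw [pull_apply]
  exact unitsField_mem_unitaryUnits _ _

/-- ★★ **MULTIPLIER FORM ⟹ ORTHOGONALITY, ON THE MEMBER'S `L²` SPACE OF GAUGE PARAMETERS.**  If the one-form `A` satisfies print's projected Landau condition (1.38) relative to `W`
in the multiplier form of record on the based pullbacks — `IsLandau138 L k η ℤ³ (torusLam k) W♯ A♯`: «Δ^η_W(D^{η*}_W A) = Q′_k(W)ᵀμ» — and the tower transporters `W̄ʲ(Γ)`, `j ≤ k`, are
unitary, then for every gauge parameter `λ` in print's residual algebra `N(Q′_k(W))` (`Q′_k(W)λ♯ = 0` on the whole level-`k` lattice): `⟪Δ^η_W λ̃, D*_W Ã⟫ = 0` in brick L0a's weighted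
`L²` — i.e. `D*_W Ã ⊥ Δ^η_W N(Q′_k(W)) = ℛ`, print's «R(W)D^{η*}_W A = 0» ((3.21): `R` = the orthogonal projection onto `ℛ`).  Proof: both letters are `toL2S` of route letters (§2),
the `L²` product is `c₀·Σ_{x∈T} tr((Δλ)(x)ᴴ(D*A)(x))`, the torus sum is the cell sum of the pullbacks (§1), `(Δ^η_W λ)ᴴ = Δ^η_W(λᴴ)` (unitary `W`), and pub-ymgap's cell identity
`sum_box_trace_covLap_mul_covDivB_eq_zero_of_isLandau138` (block transposes + `Q′_kλᴴ = (Q′_kλ)ᴴ = 0`).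
[cite: Balaban1985RegularSpaces, (1.38) p.82, (1.42) p.83, p.77; Balaban1985BackgroundPropagators, (3.19) p.393, (3.20)–(3.21) p.394, (3.23) p.394, p.391; Balaban1985Variational, (21) p.281] -/
theorem inner_covLapSite_DstarL2_eq_zero_of_isLandau138
    (W : GaugeField (F.P K) 0 (Matrix.specialUnitaryGroup (Fin 2) ℂ)) (A : PBond (F.P K) 0 → Matrix (Fin 2) (Fin 2) ℂ)
    (h138 : IsLandau138 (F.P K).L (K - n) (eta F n K) (Set.univ : Set (LSite (F.P K).d)) (torusLam (K - n))
      (pull (bgUnits F K W) (basePt F n K)) (pull A (basePt F n K)))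
    (hT : ∀ j, j ≤ K - n → ∀ z y : LSite (F.P K).d,
      bgT (F.P K).L (pull (bgUnits F K W) (basePt F n K)) j z y ∈ unitaryUnits (Matrix (Fin 2) (Fin 2) ℂ))
    (l : Site (F.P K) 0 → Matrix (Fin 2) (Fin 2) ℂ)
    (hl : ∀ y : LSite (F.P K).d,
      QprimeIter (zdBlocking (F.P K).d (F.P K).L) (bgT (F.P K).L (pull (bgUnits F K W) (basePt F n K))) (K - n)
        (fun z => l (transl (basePt F n K) z)) y = 0) :
    ⟪covLapSite F n K c₀ W (toL2S F K c₀ l), DstarL2 F n K c₀ W (toL2 F K c₀ A)⟫_ℂ = 0 := by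
  letI : CStarAlgebra (Matrix (Fin 2) (Fin 2) ℂ) := B10Eq29TubeLine.cstarAlgebraMatrix 2
  have hVu : ∀ (z : LSite (F.P K).d) (κ : Fin (F.P K).d), pull (bgUnits F K W) (basePt F n K) z κ ∈ unitaryUnits (Matrix (Fin 2) (Fin 2) ℂ) :=
    pull_bgUnits_mem_unitaryUnits W (basePt F n K)
  -- both letters are `toL2S` of route letters; expand the `L²` product as a site sum and fold the torus sum onto the period cell
  rw [covLapSite_toL2S_eq, DstarL2_toL2_eq, inner_toL2S, sum_univ_eq_sum_box_transl (basePt F n K)]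
  -- pointwise pull dictionary: the summand is `tr((Δ^η_{W♯}λ♯ᴴ)(z)·(D^{η*}_{W♯}A♯)(z))`
  have hpt : ∀ z : LSite (F.P K).d,
      (covDivFormT (eta F n K) (bgUnits F K W) (fun b => covDerivFwdT (eta F n K) (bgUnits F K W) b.2 l b.1) (transl (basePt F n K) z)).conjTranspose
        * covDivFormT (eta F n K) (bgUnits F K W) A (transl (basePt F n K) z)
      = covLap (eta F n K) (pull (bgUnits F K W) (basePt F n K)) (fun z' => star (l (transl (basePt F n K) z'))) z
        * covDivB (eta F n K) (pull (bgUnits F K W) (basePt F n K)) (pull A (basePt F n K)) z := by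
    intro z
    have h1 := B9Eq321LandauProjectionZd.star_covLap (eta F n K) hVu (fun z' => l (transl (basePt F n K) z')) z
    rw [covLap_pull_site] at h1
    rw [covDivB_pull, ← h1, Matrix.star_eq_conjTranspose]
  rw [Finset.sum_congr rfl fun z _ => by rw [hpt z]]
  -- pub-ymgap's cell identity for the tracial pairing
  have key := B9Eq321LandauOrthogonalZdPer.sum_box_trace_covLap_mul_covDivB_eq_zero_of_isLandau138
    (Matrix.traceLinearMap (Fin 2) ℂ ℂ) (fun a b => Matrix.trace_mul_comm a b)
    (isPeriodic_pull (bgUnits F K W) (basePt F n K)) (pow_dvd_sitesPerDir_zero F n K) (isPeriodic_pull A (basePt F n K)) h138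
    (isPeriodic_comp_transl (basePt F n K) (fun x => star (l x))) ?_
  · simp only [Matrix.traceLinearMap_apply] at key
    rw [key, mul_zero]
  -- `Q′_jλᴴ = 0` on `Λ_j`: only the top level `j = k` is constrained (`torusLam`), and there `Q′_kλᴴ = (Q′_kλ)ᴴ = 0`
  intro j hj y hy
  by_cases hjk : j = K - n
  · subst hjk
    have hs := B9Eq325ProjFormulaZdLevels.star_QprimeIter_le hT (fun z => l (transl (basePt F n K) z)) (K - n) le_rfl y
    rw [hl y, star_zero] at hs
    -- `starFun f = fun z => star (f z)` by `rfl`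
    exact hs.symm
  · simp only [torusLam, if_neg hjk, Set.mem_empty_iff_false] at hy

/-- ★★★ **THE (LANDAU-S) EQUATION OF THE E′ JUNCTION DOOR AT THE COMB SLOT: `R(W)(D*_W Ã) = 0` for `R(W) = projR (Δ^η_W) Q′`**, for EVERY `ℂ`-linear averaging `Q′` of the gauge
parameters whose kernel lies in print's residual algebra `N(Q′_k(W))` (in particular the print-literal `Q′_k(W)` of [B9] (3.17)–(3.19) read on `L²`): `IsLandau138` for `(W♯, A♯)` and unitary
tower transporters ⟹ `projR (covLapSite W) Q′ (DstarL2 W (toL2 A)) = 0` — the slot equation `Rr W (DstarL2 W (toL2 …)) = 0` of ✓`hcoW_of_sigmaRowsW_slots` at `Rr := projR (covLapSite W) Q′`.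
[cite: Balaban1985BackgroundPropagators, (3.20)–(3.21) p.394; Balaban1985RegularSpaces, (1.38) p.82; Balaban1985Variational, (21) p.281] -/
theorem projR_covLapSite_eq_zero_of_isLandau138
    (W : GaugeField (F.P K) 0 (Matrix.specialUnitaryGroup (Fin 2) ℂ)) (A : PBond (F.P K) 0 → Matrix (Fin 2) (Fin 2) ℂ)
    (h138 : IsLandau138 (F.P K).L (K - n) (eta F n K) (Set.univ : Set (LSite (F.P K).d)) (torusLam (K - n))
      (pull (bgUnits F K W) (basePt F n K)) (pull A (basePt F n K)))
    (hT : ∀ j, j ≤ K - n → ∀ z y : LSite (F.P K).d,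
      bgT (F.P K).L (pull (bgUnits F K W) (basePt F n K)) j z y ∈ unitaryUnits (Matrix (Fin 2) (Fin 2) ℂ))
    {F' : Type*} [AddCommGroup F'] [Module ℂ F'] (Q' : SiteL2K ℂ 3 (periodsT3 F K) c₀ W₂ →ₗ[ℂ] F')
    (hQ' : ∀ v, Q' v = 0 → ∀ y : LSite (F.P K).d,
      QprimeIter (zdBlocking (F.P K).d (F.P K).L) (bgT (F.P K).L (pull (bgUnits F K W) (basePt F n K))) (K - n)
        (fun z => (toL2S F K c₀).symm v (transl (basePt F n K) z)) y = 0) :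
    projR (covLapSite F n K c₀ W) Q' (DstarL2 F n K c₀ W (toL2 F K c₀ A)) = 0 := by
  haveI : CompleteSpace ↥((LinearMap.ker Q').map (covLapSite F n K c₀ W)) := FiniteDimensional.complete ℂ _
  change ((LinearMap.ker Q').map (covLapSite F n K c₀ W)).starProjection (DstarL2 F n K c₀ W (toL2 F K c₀ A)) = 0
  rw [Submodule.starProjection_apply_eq_zero_iff, Submodule.mem_orthogonal]
  rintro u ⟨v, hv, rfl⟩
  have h := inner_covLapSite_DstarL2_eq_zero_of_isLandau138 (c₀ := c₀) W A h138 hT ((toL2S F K c₀).symm v) (hQ' v (LinearMap.mem_ker.1 hv))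
  rwa [LinearEquiv.apply_symm_apply] at h

/-- The same for the scaled exponent `X = c·A` (the door's `toL2 (eta F n K • A)`): the slot equation is linear in the one-form. [cite: Balaban1985Variational, (19)–(21) p.281] -/
theorem projR_covLapSite_smul_eq_zero_of_isLandau138
    (W : GaugeField (F.P K) 0 (Matrix.specialUnitaryGroup (Fin 2) ℂ)) (A : PBond (F.P K) 0 → Matrix (Fin 2) (Fin 2) ℂ)
    (h138 : IsLandau138 (F.P K).L (K - n) (eta F n K) (Set.univ : Set (LSite (F.P K).d)) (torusLam (K - n))
      (pull (bgUnits F K W) (basePt F n K)) (pull A (basePt F n K)))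
    (hT : ∀ j, j ≤ K - n → ∀ z y : LSite (F.P K).d,
      bgT (F.P K).L (pull (bgUnits F K W) (basePt F n K)) j z y ∈ unitaryUnits (Matrix (Fin 2) (Fin 2) ℂ))
    {F' : Type*} [AddCommGroup F'] [Module ℂ F'] (Q' : SiteL2K ℂ 3 (periodsT3 F K) c₀ W₂ →ₗ[ℂ] F')
    (hQ' : ∀ v, Q' v = 0 → ∀ y : LSite (F.P K).d,
      QprimeIter (zdBlocking (F.P K).d (F.P K).L) (bgT (F.P K).L (pull (bgUnits F K W) (basePt F n K))) (K - n)
        (fun z => (toL2S F K c₀).symm v (transl (basePt F n K) z)) y = 0) (c : ℝ) :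
    projR (covLapSite F n K c₀ W) Q' (DstarL2 F n K c₀ W (toL2 F K c₀ (c • A))) = 0 := by
  have hcA : c • A = ((c : ℝ) : ℂ) • A := by
    funext b
    exact RCLike.real_smul_eq_coe_smul (K := ℂ) c (A b)
  rw [hcA, LinearEquiv.map_smul, map_smul, map_smul, projR_covLapSite_eq_zero_of_isLandau138 (c₀ := c₀) W A h138 hT Q' hQ', smul_zero]

/-- ★★★ **THE SAME FROM THE PREDICATE `IsLandauPrint W X`** (the letter ✓`exists_sigmaRep_of_thm2S` supplies; `X = ηA`, `A = η⁻¹X`): `projR (covLapSite W) Q′ (DstarL2 W (toL2 X)) = 0`.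
[cite: Balaban1985Variational, (21) p.281; Balaban1985RegularSpaces, (1.38) p.82; Balaban1985BackgroundPropagators, (3.20)–(3.21) p.394] -/
theorem projR_covLapSite_eq_zero_of_isLandauPrint
    (W : GaugeField (F.P K) 0 (Matrix.specialUnitaryGroup (Fin 2) ℂ)) (X : PBond (F.P K) 0 → Matrix (Fin 2) (Fin 2) ℂ) (hLan : IsLandauPrint F n K W X)
    (hT : ∀ j, j ≤ K - n → ∀ z y : LSite (F.P K).d,
      bgT (F.P K).L (pull (bgUnits F K W) (basePt F n K)) j z y ∈ unitaryUnits (Matrix (Fin 2) (Fin 2) ℂ))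
    {F' : Type*} [AddCommGroup F'] [Module ℂ F'] (Q' : SiteL2K ℂ 3 (periodsT3 F K) c₀ W₂ →ₗ[ℂ] F')
    (hQ' : ∀ v, Q' v = 0 → ∀ y : LSite (F.P K).d,
      QprimeIter (zdBlocking (F.P K).d (F.P K).L) (bgT (F.P K).L (pull (bgUnits F K W) (basePt F n K))) (K - n)
        (fun z => (toL2S F K c₀).symm v (transl (basePt F n K) z)) y = 0) :
    projR (covLapSite F n K c₀ W) Q' (DstarL2 F n K c₀ W (toL2 F K c₀ X)) = 0 := by
  have hX : X = (eta F n K) • (fun b => (eta F n K)⁻¹ • X b) := by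
    funext b
    rw [Pi.smul_apply, smul_inv_smul₀ (eta_pos F n K).ne']
  rw [hX]
  exact projR_covLapSite_smul_eq_zero_of_isLandau138 (c₀ := c₀) W (fun b => (eta F n K)⁻¹ • X b) hLan hT Q' hQ' (eta F n K)

/-- **THE SAME IN lit-balaban's `RLatticeK` LETTER** (the form of ✓`Prop7SectET3GaugeProjector.RS`: `RLatticeK η⁻¹ (adBg W) (adBgInv W) Q′ = projR (covLapSite W) Q′` by `rfl`,
✓`covLapSite_eq`): `IsLandau138` for `(W♯, A♯)` ⟹ `RLatticeK η⁻¹ (adBg W) (adBgInv W) Q′ (DstarL2 W (toL2 (c • A))) = 0`. [cite: Balaban1985BackgroundPropagators, (3.21)–(3.23) p.394] -/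
theorem RLatticeK_smul_eq_zero_of_isLandau138
    (W : GaugeField (F.P K) 0 (Matrix.specialUnitaryGroup (Fin 2) ℂ)) (A : PBond (F.P K) 0 → Matrix (Fin 2) (Fin 2) ℂ)
    (h138 : IsLandau138 (F.P K).L (K - n) (eta F n K) (Set.univ : Set (LSite (F.P K).d)) (torusLam (K - n))
      (pull (bgUnits F K W) (basePt F n K)) (pull A (basePt F n K)))
    (hT : ∀ j, j ≤ K - n → ∀ z y : LSite (F.P K).d,
      bgT (F.P K).L (pull (bgUnits F K W) (basePt F n K)) j z y ∈ unitaryUnits (Matrix (Fin 2) (Fin 2) ℂ))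
    {F' : Type*} [AddCommGroup F'] [Module ℂ F'] (Q' : SiteL2K ℂ 3 (periodsT3 F K) c₀ W₂ →ₗ[ℂ] F')
    (hQ' : ∀ v, Q' v = 0 → ∀ y : LSite (F.P K).d,
      QprimeIter (zdBlocking (F.P K).d (F.P K).L) (bgT (F.P K).L (pull (bgUnits F K W) (basePt F n K))) (K - n)
        (fun z => (toL2S F K c₀).symm v (transl (basePt F n K) z)) y = 0) (c : ℝ) :
    RLatticeK (((eta F n K : ℝ) : ℂ)⁻¹) (adBg F K W) (adBgInv F K W) Q' (DstarL2 F n K c₀ W (toL2 F K c₀ (c • A))) = 0 := by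
  rw [RLatticeK, ← covLapSite_eq]
  exact projR_covLapSite_smul_eq_zero_of_isLandau138 (c₀ := c₀) W A h138 hT Q' hQ' c

/-- **THE SAME IN THE `RLatticeK` LETTER, FROM THE PREDICATE `IsLandauPrint W X`.** [cite: Balaban1985BackgroundPropagators, (3.21)–(3.23) p.394; Balaban1985Variational, (21) p.281] -/
theorem RLatticeK_eq_zero_of_isLandauPrint
    (W : GaugeField (F.P K) 0 (Matrix.specialUnitaryGroup (Fin 2) ℂ)) (X : PBond (F.P K) 0 → Matrix (Fin 2) (Fin 2) ℂ) (hLan : IsLandauPrint F n K W X)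
    (hT : ∀ j, j ≤ K - n → ∀ z y : LSite (F.P K).d,
      bgT (F.P K).L (pull (bgUnits F K W) (basePt F n K)) j z y ∈ unitaryUnits (Matrix (Fin 2) (Fin 2) ℂ))
    {F' : Type*} [AddCommGroup F'] [Module ℂ F'] (Q' : SiteL2K ℂ 3 (periodsT3 F K) c₀ W₂ →ₗ[ℂ] F')
    (hQ' : ∀ v, Q' v = 0 → ∀ y : LSite (F.P K).d,
      QprimeIter (zdBlocking (F.P K).d (F.P K).L) (bgT (F.P K).L (pull (bgUnits F K W) (basePt F n K))) (K - n)
        (fun z => (toL2S F K c₀).symm v (transl (basePt F n K) z)) y = 0) :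
    RLatticeK (((eta F n K : ℝ) : ℂ)⁻¹) (adBg F K W) (adBgInv F K W) Q' (DstarL2 F n K c₀ W (toL2 F K c₀ X)) = 0 := by
  rw [RLatticeK, ← covLapSite_eq]
  exact projR_covLapSite_eq_zero_of_isLandauPrint (c₀ := c₀) W X hLan hT Q' hQ'

end Main

/-! ## §4 The member reading: at a printed-regular background the tower transporters are `SU(2)`-valued ([Balaban1985Averaging] Prop. 2) -/

section Member

variable (F : T3Family) {n K : ℕ} {c₀ : ℝ} [Fact (0 < c₀)]

/-- ★ **AT `W ∈ 𝔘_k(a)` THE TOWER TRANSPORTERS `W̄ʲ(Γ_{z,y})`, `j ≤ k`, ARE UNITARY** (indeed `SU(2)`-valued): `RegPr` ⟹ (1.7) for the based pullback (✓`inAk_pull_of_regPr`,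
✓`pdev_pull_lt`: plaquettes `< 2a·L^{−2k}`) ⟹ all averages `W̄ʲ`, `j ≤ k`, stay in `SU(2)` ([Balaban1985Averaging] Prop. 2 = lit `avgIter_mem` with `avgClosed_specialUnitary_of_le_twentyone`)
⟹ their contour products do.  Windows: `C₀(3)·2a ≤ ⅓`, `4a ≤ c₂′(3, L)` (L-only). [cite: Balaban1985Averaging, (52)–(53) p.26, (78)–(80) p.30; Balaban1985RegularSpaces, (1.7) p.77] -/
theorem bgT_pull_mem_unitaryUnits_of_regPr {a : ℝ} (ha : 0 < a) (hα3 : C0 (F.P K).d * (2 * a) ≤ 1 / 3) (hα4 : 4 * a ≤ c2' (F.P K).d (F.P K).L)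
    {W : GaugeField (F.P K) 0 (Matrix.specialUnitaryGroup (Fin 2) ℂ)} (hreg : RegPr F n K a W) :
    ∀ j, j ≤ K - n → ∀ z y : LSite (F.P K).d,
      bgT (F.P K).L (pull (bgUnits F K W) (basePt F n K)) j z y ∈ unitaryUnits (Matrix (Fin 2) (Fin 2) ℂ) := by
  intro j hj z y
  have hL2 : 2 ≤ (F.P K).L := by
    obtain ⟨c, hc⟩ := F.hL.1
    have h1 := F.hL.2
    show 2 ≤ F.L
    omega
  have hG := avgClosed_specialUnitary_of_le_twentyone (N := 2) (by norm_num) (F.P K).d (F.P K).L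
  have hU₀mem : ∀ x κ, pull (bgUnits F K W) (basePt F n K) x κ ∈ specialUnitaryUnits (Fin 2) := pull_toUField_mem W (basePt F n K)
  have hα : 0 < 2 * a := by positivity
  have h52 : pdev (pull (bgUnits F K W) (basePt F n K)) < 2 * a * ((((F.P K).L : ℝ) ^ (K - n))⁻¹) ^ 2 :=
    pdev_pull_lt ha (inAk_pull_of_regPr F ha.le hreg) (basePt F n K)
  have hmem := avgIter_mem (F.P K).L hL2 hG (K - n) _ hU₀mem hα hα3 (by linarith) h52 j hj
  refine specialUnitaryUnits_le_unitaryUnits ?_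
  unfold bgT B7Prop1Explicit.axialFn
  exact hol_mem_of hmem _ _

/-- ★★★ **MEMBER READING OF THE COMB LANDAU DICTIONARY**: at a printed-regular `W ∈ 𝔘_k(a)` (L-only windows `C₀(3)·2a ≤ ⅓`, `4a ≤ c₂′`), `IsLandau138` for `(W♯, A♯)` ⟹
`projR (covLapSite W) Q′ (DstarL2 W (toL2 (c • A))) = 0` for every `ℂ`-linear `Q′` with `ker Q′ ⊆ N(Q′_k(W))` and every real `c` (door letters: `c := eta F n K`).
[cite: Balaban1985BackgroundPropagators, (3.20)–(3.21) p.394; Balaban1985RegularSpaces, (1.38) p.82, (1.7) p.77; Balaban1985Averaging, Prop. 2 p.26] -/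
theorem projR_covLapSite_smul_eq_zero_of_isLandau138_of_regPr {a : ℝ} (ha : 0 < a) (hα3 : C0 (F.P K).d * (2 * a) ≤ 1 / 3)
    (hα4 : 4 * a ≤ c2' (F.P K).d (F.P K).L) {W : GaugeField (F.P K) 0 (Matrix.specialUnitaryGroup (Fin 2) ℂ)} (hreg : RegPr F n K a W)
    (A : PBond (F.P K) 0 → Matrix (Fin 2) (Fin 2) ℂ)
    (h138 : IsLandau138 (F.P K).L (K - n) (eta F n K) (Set.univ : Set (LSite (F.P K).d)) (torusLam (K - n))
      (pull (bgUnits F K W) (basePt F n K)) (pull A (basePt F n K)))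
    {F' : Type*} [AddCommGroup F'] [Module ℂ F'] (Q' : SiteL2K ℂ 3 (periodsT3 F K) c₀ W₂ →ₗ[ℂ] F')
    (hQ' : ∀ v, Q' v = 0 → ∀ y : LSite (F.P K).d,
      QprimeIter (zdBlocking (F.P K).d (F.P K).L) (bgT (F.P K).L (pull (bgUnits F K W) (basePt F n K))) (K - n)
        (fun z => (toL2S F K c₀).symm v (transl (basePt F n K) z)) y = 0) (c : ℝ) :
    projR (covLapSite F n K c₀ W) Q' (DstarL2 F n K c₀ W (toL2 F K c₀ (c • A))) = 0 :=
  projR_covLapSite_smul_eq_zero_of_isLandau138 (c₀ := c₀) W A h138 (bgT_pull_mem_unitaryUnits_of_regPr F ha hα3 hα4 hreg) Q' hQ' c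

/-- ★★★ **MEMBER READING FROM THE PREDICATE**: `RegPr F n K a W` (windows as above) and `IsLandauPrint F n K W X` ⟹ `projR (covLapSite W) Q′ (DstarL2 W (toL2 X)) = 0` for every
`ℂ`-linear `Q′` with `ker Q′ ⊆ N(Q′_k(W))`. [cite: Balaban1985Variational, (21) p.281; Balaban1985RegularSpaces, (1.38) p.82, (1.7) p.77; Balaban1985BackgroundPropagators, (3.20)–(3.21) p.394] -/
theorem projR_covLapSite_eq_zero_of_isLandauPrint_of_regPr {a : ℝ} (ha : 0 < a) (hα3 : C0 (F.P K).d * (2 * a) ≤ 1 / 3)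
    (hα4 : 4 * a ≤ c2' (F.P K).d (F.P K).L) {W : GaugeField (F.P K) 0 (Matrix.specialUnitaryGroup (Fin 2) ℂ)} (hreg : RegPr F n K a W)
    {X : PBond (F.P K) 0 → Matrix (Fin 2) (Fin 2) ℂ} (hLan : IsLandauPrint F n K W X)
    {F' : Type*} [AddCommGroup F'] [Module ℂ F'] (Q' : SiteL2K ℂ 3 (periodsT3 F K) c₀ W₂ →ₗ[ℂ] F')
    (hQ' : ∀ v, Q' v = 0 → ∀ y : LSite (F.P K).d,
      QprimeIter (zdBlocking (F.P K).d (F.P K).L) (bgT (F.P K).L (pull (bgUnits F K W) (basePt F n K))) (K - n)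
        (fun z => (toL2S F K c₀).symm v (transl (basePt F n K) z)) y = 0) :
    projR (covLapSite F n K c₀ W) Q' (DstarL2 F n K c₀ W (toL2 F K c₀ X)) = 0 :=
  projR_covLapSite_eq_zero_of_isLandauPrint (c₀ := c₀) W X hLan (bgT_pull_mem_unitaryUnits_of_regPr F ha hα3 hα4 hreg) Q' hQ'

end Member

end Summit.QuantumFields.YangMills.Theorems.Prop7LandauCombDict

end
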